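import Mathlib
import HarnessLib
import Summits.HubbardSuperconductivity.HubbardSuperconductivity.Theorems.KLProgrammeKLRegimeEngineE4ScaleDoor

/-!
# (E4)ₙ door, bridge to the scale-`0` bookkeeping weight: `klScaleWt_n ≤ gridLabelWt` at every scale

Cell gate-hubbard-kl, seat hubbard-kl-k3c3-p2 (g6); companion of `…EngineE4ScaleDoor` (p518391).  The scale-`0` chain of k3c2-p1
(`…ScaleZeroE4Assembly`) runs the weighted determinant-bounded step with the weight `gridLabelWt L (4M) β = 1 + diam`; since
`Λ_n = klScale klE0 n ≤ klE0 = 1/32 ≤ 1`, the scale-`n` weight `klScaleWt L M β n = 1 + Λ_n·diam` is dominated by it, so every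
`gridLabelWt`-weighted pinned bound of the analysed scale-`n` action is also a `klWtPinnedSum` bound: a producer holding a step output in `gridLabelWt`
currency discharges the degree-`4` clause of `KernelNormsWt` / `E4ScaleAt` with no re-proof.
* `klScale_klE0_le_one`, `klScaleWt_le_gridLabelWt`, **`klWtPinnedSum_le_of_gridLabelWt`**.
Pure bookkeeping; nothing about the model is asserted.
-/

noncomputable section

namespace Summit.HubbardSuperconductivity.HubbardSuperconductivity.Theorems.EngineV8

set_option linter.dupNamespace false -- summit = problem name (single-conjunct summit), D-0017

open Real Finset Literature.MathematicalPhysics.QuantumLattice Literature.Probability.LatticeModels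
open Literature.Probability.LatticeModels.BattleFederbush
open Literature.MathematicalPhysics.QuantumLattice.GrassmannAlgebra
open Summit.HubbardSuperconductivity.HubbardSuperconductivity.Theorems.KLRegimeSplit
open Summit.HubbardSuperconductivity.HubbardSuperconductivity.Theorems.KLProgrammeLegKernels

/-- `Λ_n ≤ 1`. -/
theorem klScale_klE0_le_one (n : ℕ) : klScale klE0 n ≤ 1 := by
  unfold klScale klE0
  have h4 : (1 : ℝ) ≤ (4 : ℝ) ^ n := one_le_pow₀ (by norm_num)
  have hinv : ((4 : ℝ) ^ n)⁻¹ ≤ 1 := inv_le_one_of_one_le₀ h4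
  have hinv0 : 0 ≤ ((4 : ℝ) ^ n)⁻¹ := inv_nonneg.2 (by positivity)
  nlinarith

/-- **The scale-`n` weight is dominated by the scale-`0` bookkeeping weight**: `klScaleWt L M β n S ≤ gridLabelWt L (4M) β S`. -/
theorem klScaleWt_le_gridLabelWt {L M : ℕ} (β : ℝ) (n : ℕ) (S : Finset (ZMod (2 * (2 * M)) × TorusSite 2 L)) :
    klScaleWt L M β n S ≤ gridLabelWt L (2 * (2 * M)) β S := by
  rw [klScaleWt_apply, gridLabelWt_apply]
  have hD := labelDiam_nonneg (gridLabelDist L (2 * (2 * M)) β) S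
  have := mul_le_of_le_one_left hD (klScale_klE0_le_one n)
  linarith

/-- **Weighted pinned sums in `gridLabelWt` currency bound those in `klScaleWt_n` currency** (`β ≥ 0`): if the `gridLabelWt`-weighted pinned sum of the
analysed scale-`n` action in degree `m` at `(q, w)` is `≤ B`, then `klWtPinnedSum … n m q w ≤ ε_x^{m−1} · B`. -/
theorem klWtPinnedSum_le_of_gridLabelWt {L M : ℕ} [NeZero L] {β : ℝ} (hβ : 0 ≤ β) (U μ : ℝ) (K : TrigPolyC4v) (n m : ℕ) (q : Fin m)
    (w : SpaceTimeIdx L M × SectorLeg (sectorCount n)) {B : ℝ}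
    (h : ∑ X ∈ univ.filter (fun X : Fin m → SpaceTimeIdx L M × SectorLeg (sectorCount n) => X q = w),
      gridLabelWt L (2 * (2 * M)) β ((univ.image X).image (latticeLegPos (2 * (2 * M)))) *
        ‖kernel ℂ (ExteriorAlgebra.map (Matrix.toLin' (sectorAnalysisMatrix L M β (klAnisoFamily L M β μ K klE0 n)))
            (klEffectiveAction L M β U μ K klE0 n)) m X‖ ≤ B) :
    klWtPinnedSum L M β U μ K n m q w ≤ imagTimeWeight β M ^ (m - 1) * B := by
  rw [klWtPinnedSum_def]
  refine mul_le_mul_of_nonneg_left (le_trans (sum_le_sum fun X _ => ?_) h) (pow_nonneg (imagTimeWeight_nonneg hβ M) _)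
  exact mul_le_mul_of_nonneg_right (klScaleWt_le_gridLabelWt β n _) (norm_nonneg _)

end Summit.HubbardSuperconductivity.HubbardSuperconductivity.Theorems.EngineV8

end
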